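import Mathlib
import Summits.ValiantsHypothesis.ValiantsHypothesis.Theorems.KPlusLogSqLawWeakLiftingTowerGraftSignedCrossingFlow

/-!
# Tower graft line — SIGNED CROSSINGS VI: transversal roots are finite in number (compactness), and the finiteness-free laws

Structure file for LINE (B) `Cruxes/WeakLifting/Lines/tower_graft.lean` (crux `WeakLifting` = stmt-ValiantsHypothesis-19561),
sixth of the SIGNED-CROSSING series.  Files III and V carried a finiteness hypothesis / a covering finset for the roots.  Here it is
DISCHARGED: a root at which the derivative is definite (either sign) on the kernel is isolated on both sides, so by compactness of `[a, b]`
a family that is transversal (in either direction) at every root has finitely many roots there.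

§1 `eventually_det_ne_zero_left_of_down` / `eventually_det_ne_zero_right_of_down` (isolation at a downward-transversal point, through `−H`),
   `roots_mem_nhds_of_isolated` (an isolated root has a neighbourhood free of other roots, as a `𝓝`-membership),
   ★ `finite_roots_of_transversal` (upward at every point of `[a, b]` ⇒ `{u ∈ [a, b] | det H u = 0}` finite),
   ★ `finite_roots_of_signed_transversal` (upward on `U`, downward off `U` ⇒ finite).
§2 the laws of files III / V with the root set supplied by §1: ★ `card_add_negCount_le'` (= `card_add_negCount_le` WITHOUT the finiteness
   hypothesis: for every finite set `T` of roots in `(a, b]`, `#T + ν₋(b) ≤ ν₋(a)`), `card_roots_add_negCount_le` (the full root set of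
   `(a, b]` itself), `sum_zeroCount_roots_add_negCount_eq` (`Σ_{roots of (a, b]} ν₀ + ν₋(b) = ν₋(a)`), and the signed form
   `sum_up_roots_add_negCount_eq_sum_down_roots_add_negCount` (`Σ_{up-roots of (a, b)} ν₀ + ν₋(b) = Σ_{down-roots of (a, b)} ν₀ + ν₋(a)`).
Zero stub credit; S4/S5, TowerB, WeakLifting, Conjecture B, 18050, VP ≠ VNP untouched.  Def-free; Mathlib + files I–V.
Seat: prover val-sym-lift-p2 g24, `--supports stmt-ValiantsHypothesis-19561 --as helper`.  [folklore; the packaging for the line is this work]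
-/

-- `Summit.ValiantsHypothesis.ValiantsHypothesis.…` repeats a component by the D-0017 layout
-- (single-conjunct summit), which the `dupNamespace` linter flags; the name is mandated.
set_option linter.dupNamespace false
set_option autoImplicit false

namespace Summit.ValiantsHypothesis.ValiantsHypothesis.Theorems.KPlusLogSqLaw.TowerGraft

open Matrix Finset Filter
open scoped BigOperators Topology
open Literature.Algebra.Polynomial.MiddleMatrixSignature (card_eigenvalues_neg_add_zero_add_pos)

namespace SignedCrossing

variable {ι : Type} [Fintype ι] [DecidableEq ι]

/-! ## §1 Isolation and finiteness -/

section Finite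

/-- isolation from the left at a downward-transversal point (the upward law for `−H`). [folklore] -/
theorem eventually_det_ne_zero_left_of_down (H : ℝ → Matrix ι ι ℝ) (hH : ∀ u, (H u).IsHermitian) (t : ℝ) (H' : ℝ → Matrix ι ι ℝ)
    (hd : ∀ i j, HasDerivAt (fun u => H u i j) (H' t i j) t)
    (htr : ∀ v : ι → ℝ, H t *ᵥ v = 0 → v ≠ 0 → v ⬝ᵥ H' t *ᵥ v < 0) :
    ∀ᶠ u in 𝓝[<] t, (H u).det ≠ 0 := by
  have hH' : ∀ u, (-H u).IsHermitian := fun u => (hH u).neg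
  have hd' : ∀ i j, HasDerivAt (fun u => (-H u) i j) ((fun u => -H' u) t i j) t := fun i j => (hd i j).neg
  have htr' : ∀ v : ι → ℝ, (-H t) *ᵥ v = 0 → v ≠ 0 → 0 < v ⬝ᵥ (-H' t) *ᵥ v := fun v hv hv0 => by
    rw [Matrix.neg_mulVec, neg_eq_zero] at hv
    rw [Matrix.neg_mulVec, dotProduct_neg]
    exact neg_pos.mpr (htr v hv hv0)
  refine (eventually_det_ne_zero_left (fun u => -H u) hH' t (fun u => -H' u) hd' htr').mono fun u hu h0 => hu ?_
  show (-H u).det = 0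
  rw [Matrix.det_neg, h0, mul_zero]

/-- isolation from the right at a downward-transversal point. [folklore] -/
theorem eventually_det_ne_zero_right_of_down (H : ℝ → Matrix ι ι ℝ) (hH : ∀ u, (H u).IsHermitian) (t : ℝ) (H' : ℝ → Matrix ι ι ℝ)
    (hd : ∀ i j, HasDerivAt (fun u => H u i j) (H' t i j) t)
    (htr : ∀ v : ι → ℝ, H t *ᵥ v = 0 → v ≠ 0 → v ⬝ᵥ H' t *ᵥ v < 0) :
    ∀ᶠ u in 𝓝[>] t, (H u).det ≠ 0 := by
  have hH' : ∀ u, (-H u).IsHermitian := fun u => (hH u).neg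
  have hd' : ∀ i j, HasDerivAt (fun u => (-H u) i j) ((fun u => -H' u) t i j) t := fun i j => (hd i j).neg
  have htr' : ∀ v : ι → ℝ, (-H t) *ᵥ v = 0 → v ≠ 0 → 0 < v ⬝ᵥ (-H' t) *ᵥ v := fun v hv hv0 => by
    rw [Matrix.neg_mulVec, neg_eq_zero] at hv
    rw [Matrix.neg_mulVec, dotProduct_neg]
    exact neg_pos.mpr (htr v hv hv0)
  refine (eventually_det_ne_zero_right (fun u => -H u) hH' t (fun u => -H' u) hd' htr').mono fun u hu h0 => hu ?_
  show (-H u).det = 0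
  rw [Matrix.det_neg, h0, mul_zero]

omit [Fintype ι] [DecidableEq ι] in
/-- a point isolated among the roots on both sides has a neighbourhood containing no other root. [folklore] -/
theorem roots_mem_nhds_of_isolated {R : Set ℝ} (t : ℝ) (hL : ∀ᶠ u in 𝓝[<] t, u ∉ R) (hR : ∀ᶠ u in 𝓝[>] t, u ∉ R) :
    {u : ℝ | u = t ∨ u ∉ R} ∈ 𝓝 t := by
  have h1 : ∀ᶠ u in 𝓝[≠] t, u = t ∨ u ∉ R := by
    rw [← nhdsLT_sup_nhdsGT]
    exact eventually_sup.mpr ⟨hL.mono fun u hu => Or.inr hu, hR.mono fun u hu => Or.inr hu⟩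
  have h2 : ∀ᶠ u in 𝓝 t, u = t ∨ u ∉ R := by
    rw [← nhdsNE_sup_pure]
    exact eventually_sup.mpr ⟨h1, eventually_pure.mpr (Or.inl rfl)⟩
  exact h2

omit [Fintype ι] [DecidableEq ι] in
/-- compactness: if every point of `[a, b]` has a neighbourhood free of other members of `R`, then `R ∩ [a, b]` is finite. [folklore] -/
theorem finite_of_locally_single {R : Set ℝ} {a b : ℝ} (h : ∀ x, a ≤ x → x ≤ b → {u : ℝ | u = x ∨ u ∉ R} ∈ 𝓝 x) :
    {u : ℝ | a ≤ u ∧ u ≤ b ∧ u ∈ R}.Finite := by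
  obtain ⟨s, -, hcov⟩ := (isCompact_Icc (a := a) (b := b)).elim_nhds_subcover (fun x => {u : ℝ | u = x ∨ u ∉ R})
    fun x hx => h x hx.1 hx.2
  refine s.finite_toSet.subset fun u hu => ?_
  rw [Set.mem_setOf_eq] at hu
  have hmem := hcov ⟨hu.1, hu.2.1⟩
  simp only [Set.mem_iUnion, Set.mem_setOf_eq] at hmem
  obtain ⟨x, hx, hux⟩ := hmem
  rcases hux with rfl | hnot
  · exact hx
  · exact absurd hu.2.2 hnot

/-- **finitely many roots under upward transversality.**  Entries differentiable on `[a, b]`, `vᵀ(H′ u)v > 0` on `ker H(u) ∖ 0` at every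
`u ∈ [a, b]` (vacuous off the roots): the roots of `det H` in `[a, b]` form a finite set. [folklore; packaging this work] -/
theorem finite_roots_of_transversal (H H' : ℝ → Matrix ι ι ℝ) (hH : ∀ u, (H u).IsHermitian) {a b : ℝ}
    (hd : ∀ u, a ≤ u → u ≤ b → ∀ i j, HasDerivAt (fun x => H x i j) (H' u i j) u)
    (htr : ∀ u, a ≤ u → u ≤ b → ∀ v : ι → ℝ, H u *ᵥ v = 0 → v ≠ 0 → 0 < v ⬝ᵥ H' u *ᵥ v) :
    {u : ℝ | a ≤ u ∧ u ≤ b ∧ (H u).det = 0}.Finite := by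
  have h := finite_of_locally_single (R := {u : ℝ | (H u).det = 0}) (a := a) (b := b) fun x hax hxb =>
    roots_mem_nhds_of_isolated x
      ((eventually_det_ne_zero_left H hH x H' (hd x hax hxb) (htr x hax hxb)).mono fun _ hu => hu)
      ((eventually_det_ne_zero_right H hH x H' (hd x hax hxb) (htr x hax hxb)).mono fun _ hu => hu)
  exact h

/-- **finitely many roots under signed transversality** (upward on `U`, downward off `U`, at every point of `[a, b]`). [this work] -/
theorem finite_roots_of_signed_transversal (H H' : ℝ → Matrix ι ι ℝ) (hH : ∀ u, (H u).IsHermitian) {a b : ℝ}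
    (hd : ∀ u, a ≤ u → u ≤ b → ∀ i j, HasDerivAt (fun x => H x i j) (H' u i j) u) (U : Finset ℝ)
    (hup : ∀ u, a ≤ u → u ≤ b → u ∈ U → ∀ v : ι → ℝ, H u *ᵥ v = 0 → v ≠ 0 → 0 < v ⬝ᵥ H' u *ᵥ v)
    (hdown : ∀ u, a ≤ u → u ≤ b → u ∉ U → ∀ v : ι → ℝ, H u *ᵥ v = 0 → v ≠ 0 → v ⬝ᵥ H' u *ᵥ v < 0) :
    {u : ℝ | a ≤ u ∧ u ≤ b ∧ (H u).det = 0}.Finite := by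
  refine finite_of_locally_single (R := {u : ℝ | (H u).det = 0}) (a := a) (b := b) fun x hax hxb => ?_
  by_cases hx : x ∈ U
  · exact roots_mem_nhds_of_isolated x
      ((eventually_det_ne_zero_left H hH x H' (hd x hax hxb) (hup x hax hxb hx)).mono fun _ hu => hu)
      ((eventually_det_ne_zero_right H hH x H' (hd x hax hxb) (hup x hax hxb hx)).mono fun _ hu => hu)
  · exact roots_mem_nhds_of_isolated x
      ((eventually_det_ne_zero_left_of_down H hH x H' (hd x hax hxb) (hdown x hax hxb hx)).mono fun _ hu => hu)
      ((eventually_det_ne_zero_right_of_down H hH x H' (hd x hax hxb) (hdown x hax hxb hx)).mono fun _ hu => hu)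

end Finite

/-! ## §2 The laws with the root set supplied -/

section Laws

/-- **SIGNED-CROSSING LAW, counting form, no finiteness hypothesis**: upward transversality on `[a, b]` ⇒ for every finite set `T` of roots
in `(a, b]`, `#T + ν₋(b) ≤ ν₋(a)`. [this work] -/
theorem card_add_negCount_le' (H H' : ℝ → Matrix ι ι ℝ) (hH : ∀ u, (H u).IsHermitian) {a b : ℝ}
    (hd : ∀ u, a ≤ u → u ≤ b → ∀ i j, HasDerivAt (fun x => H x i j) (H' u i j) u)
    (htr : ∀ u, a ≤ u → u ≤ b → ∀ v : ι → ℝ, H u *ᵥ v = 0 → v ≠ 0 → 0 < v ⬝ᵥ H' u *ᵥ v)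
    (hab : a ≤ b) (T : Finset ℝ) (hT : ∀ t ∈ T, a < t ∧ t ≤ b ∧ (H t).det = 0) :
    T.card + (univ.filter fun i => (hH b).eigenvalues i < 0).card ≤ (univ.filter fun i => (hH a).eigenvalues i < 0).card :=
  card_add_negCount_le H H' hH hd htr hab
    ((finite_roots_of_transversal H H' hH hd htr).subset fun _ hu => ⟨hu.1.le, hu.2.1, hu.2.2⟩) T hT

/-- the full root set of `(a, b]`: `#{roots in (a, b]} + ν₋(b) ≤ ν₋(a)` (in particular `≤ |ι|` roots). [this work] -/
theorem card_roots_add_negCount_le (H H' : ℝ → Matrix ι ι ℝ) (hH : ∀ u, (H u).IsHermitian) {a b : ℝ}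
    (hd : ∀ u, a ≤ u → u ≤ b → ∀ i j, HasDerivAt (fun x => H x i j) (H' u i j) u)
    (htr : ∀ u, a ≤ u → u ≤ b → ∀ v : ι → ℝ, H u *ᵥ v = 0 → v ≠ 0 → 0 < v ⬝ᵥ H' u *ᵥ v) (hab : a ≤ b)
    (hfin : {u : ℝ | a < u ∧ u ≤ b ∧ (H u).det = 0}.Finite) :
    hfin.toFinset.card + (univ.filter fun i => (hH b).eigenvalues i < 0).card ≤ (univ.filter fun i => (hH a).eigenvalues i < 0).card :=
  card_add_negCount_le' H H' hH hd htr hab hfin.toFinset fun _ ht => (Set.Finite.mem_toFinset hfin).mp ht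

/-- **SIGNED-CROSSING LAW on the root set**: `Σ_{roots t ∈ (a, b]} ν₀(t) + ν₋(b) = ν₋(a)` (the root set is finite by
`finite_roots_of_transversal`; any of its `Set.Finite` witnesses may be supplied). [this work] -/
theorem sum_zeroCount_roots_add_negCount_eq (H H' : ℝ → Matrix ι ι ℝ) (hH : ∀ u, (H u).IsHermitian) {a b : ℝ}
    (hd : ∀ u, a ≤ u → u ≤ b → ∀ i j, HasDerivAt (fun x => H x i j) (H' u i j) u)
    (htr : ∀ u, a ≤ u → u ≤ b → ∀ v : ι → ℝ, H u *ᵥ v = 0 → v ≠ 0 → 0 < v ⬝ᵥ H' u *ᵥ v) (hab : a ≤ b)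
    (hfin : {u : ℝ | a < u ∧ u ≤ b ∧ (H u).det = 0}.Finite) :
    (∑ t ∈ hfin.toFinset, (univ.filter fun i => (hH t).eigenvalues i = 0).card) +
        (univ.filter fun i => (hH b).eigenvalues i < 0).card = (univ.filter fun i => (hH a).eigenvalues i < 0).card :=
  sum_zeroCount_add_negCount_eq H H' hH hd htr hab hfin.toFinset
    (fun _ ht => ⟨((Set.Finite.mem_toFinset hfin).mp ht).1, ((Set.Finite.mem_toFinset hfin).mp ht).2.1⟩)
    fun _ hu1 hu2 h0 => (Set.Finite.mem_toFinset hfin).mpr ⟨hu1, hu2, h0⟩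

/-- the root set of `(a, b]` under upward transversality IS finite (the witness for the two statements above). [this work] -/
theorem finite_roots_Ioc_of_transversal (H H' : ℝ → Matrix ι ι ℝ) (hH : ∀ u, (H u).IsHermitian) {a b : ℝ}
    (hd : ∀ u, a ≤ u → u ≤ b → ∀ i j, HasDerivAt (fun x => H x i j) (H' u i j) u)
    (htr : ∀ u, a ≤ u → u ≤ b → ∀ v : ι → ℝ, H u *ᵥ v = 0 → v ≠ 0 → 0 < v ⬝ᵥ H' u *ᵥ v) :
    {u : ℝ | a < u ∧ u ≤ b ∧ (H u).det = 0}.Finite :=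
  (finite_roots_of_transversal H H' hH hd htr).subset fun _ hu => ⟨hu.1.le, hu.2.1, hu.2.2⟩

/-- the root set of `(a, b)` under signed transversality is finite. [this work] -/
theorem finite_roots_Ioo_of_signed_transversal (H H' : ℝ → Matrix ι ι ℝ) (hH : ∀ u, (H u).IsHermitian) {a b : ℝ}
    (hd : ∀ u, a ≤ u → u ≤ b → ∀ i j, HasDerivAt (fun x => H x i j) (H' u i j) u) (U : Finset ℝ)
    (hup : ∀ u, a ≤ u → u ≤ b → u ∈ U → ∀ v : ι → ℝ, H u *ᵥ v = 0 → v ≠ 0 → 0 < v ⬝ᵥ H' u *ᵥ v)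
    (hdown : ∀ u, a ≤ u → u ≤ b → u ∉ U → ∀ v : ι → ℝ, H u *ᵥ v = 0 → v ≠ 0 → v ⬝ᵥ H' u *ᵥ v < 0) :
    {u : ℝ | a < u ∧ u < b ∧ (H u).det = 0}.Finite :=
  (finite_roots_of_signed_transversal H H' hH hd U hup hdown).subset fun _ hu => ⟨hu.1.le, hu.2.1.le, hu.2.2⟩

/-- **SPECTRAL FLOW = SIGNED CROSSING COUNT on the root set**: with `a, b` non-roots,
`Σ_{up-roots of (a, b)} ν₀ + ν₋(b) = Σ_{down-roots of (a, b)} ν₀ + ν₋(a)`. [this work] -/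
theorem sum_up_roots_add_negCount_eq_sum_down_roots_add_negCount (H H' : ℝ → Matrix ι ι ℝ) (hH : ∀ u, (H u).IsHermitian)
    {a b : ℝ} (hd : ∀ u, a ≤ u → u ≤ b → ∀ i j, HasDerivAt (fun x => H x i j) (H' u i j) u) (U : Finset ℝ)
    (hup : ∀ u, a ≤ u → u ≤ b → u ∈ U → ∀ v : ι → ℝ, H u *ᵥ v = 0 → v ≠ 0 → 0 < v ⬝ᵥ H' u *ᵥ v)
    (hdown : ∀ u, a ≤ u → u ≤ b → u ∉ U → ∀ v : ι → ℝ, H u *ᵥ v = 0 → v ≠ 0 → v ⬝ᵥ H' u *ᵥ v < 0)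
    (hab : a ≤ b) (ha0 : (H a).det ≠ 0) (hb0 : (H b).det ≠ 0) (hfin : {u : ℝ | a < u ∧ u < b ∧ (H u).det = 0}.Finite) :
    (∑ t ∈ hfin.toFinset.filter (fun t => t ∈ U), (univ.filter fun i => (hH t).eigenvalues i = 0).card) +
        (univ.filter fun i => (hH b).eigenvalues i < 0).card =
      (∑ t ∈ hfin.toFinset.filter (fun t => t ∉ U), (univ.filter fun i => (hH t).eigenvalues i = 0).card) +
        (univ.filter fun i => (hH a).eigenvalues i < 0).card :=
  sum_up_add_negCount_eq_sum_down_add_negCount H H' hH hd U hup hdown hab ha0 hb0 hfin.toFinset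
    (fun _ ht => ⟨((Set.Finite.mem_toFinset hfin).mp ht).1, ((Set.Finite.mem_toFinset hfin).mp ht).2.1⟩)
    fun _ hu1 hu2 h0 => (Set.Finite.mem_toFinset hfin).mpr ⟨hu1, hu2, h0⟩

end Laws

end SignedCrossing

end Summit.ValiantsHypothesis.ValiantsHypothesis.Theorems.KPlusLogSqLaw.TowerGraft
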